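import Mathlib

/-!
# hub-lb-idea-8 g2 — Sketch for LINE idea8-L4 «T2R» (three-index EIGEN-ROWS) on crux
`Summit.Ventures.CertifiedManyBodySolver.Theses.M3PrimeEdgeSplit.LowerEdge_ge_m4o5` (stmt-Ventures-21721).

The row exported by `t2q_rows.py` for an eigenvector `u` of a three-index block `M_C(y*)` is the moment
functional `ω ↦ ω(Xᴴ X + X Xᴴ)` (T̄2 / T2′ / T2′h; for T2 bare only the first term's block, for T1 the
three-annihilator family) at the FIXED element `X = ∑ₐ uₐ bₐ`.  Soundness of the row for every state is the
first lemma below (proved, finite-dimensional density-matrix form); its expansion as a LINEAR form in the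
anticommutator moments `ω(bₐᴴ b_c + b_c bₐᴴ)` — the entries of `M_C` — is the second (proved).
Nothing here is specific to the Hubbard model; the dictionary to MENU coordinates is the CAR normal
ordering checked numerically (t2q0.py selftest, kit j299376) and is NOT formalised here.
-/

namespace HubLbIdea8T2R

open Matrix
open scoped ComplexOrder

variable {n : Type*} [Fintype n] [DecidableEq n]

/-- **T2R soundness (proved).** For a density operator `ρ ⪰ 0` and ANY operator `X`,
`Re Tr ρ (Xᴴ X + X Xᴴ) ≥ 0`.  With `X = ∑ₐ uₐ bₐ` this is the eigen-row `uᴴ M_C(ω) u ≥ 0`. -/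
theorem re_trace_mul_anticommGram_nonneg (ρ : Matrix n n ℂ) (hρ : ρ.PosSemidef) (X : Matrix n n ℂ) :
    0 ≤ ((ρ * (Xᴴ * X + X * Xᴴ)).trace).re := by
  have h1 : (X * ρ * Xᴴ).PosSemidef := hρ.mul_mul_conjTranspose_same X
  have h2 : (Xᴴ * ρ * X).PosSemidef := by
    simpa using hρ.conjTranspose_mul_mul_same X
  have t1 : (ρ * (Xᴴ * X)).trace = (X * ρ * Xᴴ).trace := by
    rw [← Matrix.mul_assoc, Matrix.trace_mul_cycle]
  have t2 : (ρ * (X * Xᴴ)).trace = (Xᴴ * ρ * X).trace := by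
    rw [← Matrix.mul_assoc, Matrix.trace_mul_cycle]
  have e : (ρ * (Xᴴ * X + X * Xᴴ)).trace = (X * ρ * Xᴴ).trace + (Xᴴ * ρ * X).trace := by
    rw [Matrix.mul_add, Matrix.trace_add, t1, t2]
  rw [e, Complex.add_re]
  have a1 := (Complex.nonneg_iff.mp h1.trace_nonneg).1
  have a2 := (Complex.nonneg_iff.mp h2.trace_nonneg).1
  linarith

/-- **T2R linearity (proved).** The row is a fixed linear combination of the block's entries:
`Tr ρ (XᴴX + XXᴴ) = ∑ₐ ∑_c conj(uₐ) u_c · Tr ρ (bₐᴴ b_c + b_c bₐᴴ)` for `X = ∑ₐ uₐ • bₐ`. -/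
theorem trace_anticommGram_expand {m : Type*} [Fintype m] (ρ : Matrix n n ℂ) (b : m → Matrix n n ℂ)
    (u : m → ℂ) :
    (ρ * ((∑ a, u a • b a)ᴴ * (∑ c, u c • b c) + (∑ c, u c • b c) * (∑ a, u a • b a)ᴴ)).trace
      = ∑ a, ∑ c, (starRingEnd ℂ) (u a) * u c * (ρ * ((b a)ᴴ * b c + b c * (b a)ᴴ)).trace := by
  simp only [Matrix.conjTranspose_sum, Matrix.conjTranspose_smul, Matrix.sum_mul, Matrix.mul_sum,
    Matrix.smul_mul, Matrix.mul_smul, Matrix.trace_add, Matrix.trace_sum,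
    Matrix.trace_smul, smul_eq_mul, Finset.mul_sum, mul_add, Finset.sum_add_distrib]
  congr 1
  · rw [Finset.sum_comm]
    apply Finset.sum_congr rfl; intro a _; apply Finset.sum_congr rfl; intro c _
    simp [mul_comm, mul_left_comm, mul_assoc]
  · apply Finset.sum_congr rfl; intro a _; apply Finset.sum_congr rfl; intro c _
    simp [mul_comm, mul_left_comm, mul_assoc]

/-- **The eigen-row inequality as served to a host (statement).** For every density operator and every
fixed coefficient vector `u`, the linear form in the anticommutator moments is nonnegative. -/
theorem eigenRow_nonneg {m : Type*} [Fintype m] (ρ : Matrix n n ℂ) (hρ : ρ.PosSemidef)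
    (b : m → Matrix n n ℂ) (u : m → ℂ) :
    0 ≤ (∑ a, ∑ c, (starRingEnd ℂ) (u a) * u c * (ρ * ((b a)ᴴ * b c + b c * (b a)ᴴ)).trace).re := by
  rw [← trace_anticommGram_expand]
  exact re_trace_mul_anticommGram_nonneg ρ hρ _

end HubLbIdea8T2R
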